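import Literature.Probability.LatticeModels.PolymerGasGeometric
import Literature.Probability.LatticeModels.PolymerPressure

/-!
# Steiner tree length on a bounded-degree cell graph; Bałaban's (2.27)/(2.29)/(2.30) — NODE O · PT-D′, PART A (§1–§3)

PART A of lens-2 g2's PT-D′ draft (HOME `pub/ym-nodeO-ideate/nodeO-cover/LENS-2-PortPTDprime-TheoremsDraft-v1.lean`, sha16 dd006e1ede30f4bd,
528 l.): §1 `steinerLength` (+ (H1) `steinerLength_singleton`, (2.30)-shape `steinerLength_of_isRConnected`), §2 (H2) = [RG-II] (2.27)
`steiner_subadd`, §3 (H3) = [RG-II] (2.29)/(2.30) `steiner_entropy`.  PART B = `BalabanUVNodesPortSteinerResummation.lean` (§4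
`geometric_resummation` = the landed PT-D ✓p783856 applied by name with (H1)–(H3) discharged, §5 rule (N), §6 item shape) carries the lens
seat's full header, the author paragraph and the honest framing.  The split (gate lint: Theorems files with proofs ≤ 400 lines) and the
re-punctuation of the cite tags to the gate grammar `[cite: Key, locator]` with the bib keys of record are the ONLY changes made by the filer
(dag-n07-e g36, director-ym №427 / chair R473); every declaration's name, namespace, statement and proof is byte-identical to the draft.
FOLKLORE lattice-animal combinatorics on the tree's `PolymerGasGeometric` (refs: [Balaban1987RG1] (1.35); [Balaban1988RG2Cluster] (2.11),
(2.27), (2.29), (2.30) p.14–18; Cammarota CMP 85 (1982); [KoteckyPreiss1986]); nothing of Bałaban's analysis is asserted, valued or discharged;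
count-neutral helper `--supports stmt-QuantumFields-20541 --as helper`.  HONEST: stub 2′ OPEN; K0⁷ NOT closed; NODE O = [RG-I] Thm 3 β-clause
p.264 — print-proved (claimed), unported; finite `𝕋⁴` at fixed `ε`; NOT continuum / OS / Clay; the Yang–Mills mass gap is NOT proved.
-/
noncomputable section

namespace Summit.QuantumFields.YangMills.Theorems.SteinerResummationDraft

open Finset Literature.Probability.LatticeModels

variable {V : Type*} [DecidableEq V]

/-! ## §1 Steiner tree length of a finite cell set -/

section Steiner

variable (R : V → V → Prop)

/-- **Steiner tree length** of a finite cell set `A` in the adjacency structure `R`: the least `n`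
such that some `R`-connected finite set of `n + 1` cells contains `A` (= the number of edges of a
shortest tree of cells connecting `A`; print's `d_k(Y)` of [RG-I] (1.35) up to normalisation).
Junk value `0` if no `R`-connected superset exists (excluded by the standing hypothesis `hconn`
below). [cite: Balaban1987RG1, (1.35); folklore] -/
def steinerLength (A : Finset V) : ℕ :=
  sInf {n : ℕ | ∃ S : Finset V, A ⊆ S ∧ IsRConnected R S ∧ S.card = n + 1}

variable {R}

omit [DecidableEq V] in
/-- An `R`-connected superset `S ⊇ A` bounds the Steiner length: `steinerLength A + 1 ≤ #S`.
[folklore] -/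
theorem steinerLength_succ_le {A S : Finset V} (hAS : A ⊆ S) (hS : IsRConnected R S) :
    steinerLength R A + 1 ≤ S.card := by
  have h1 : 1 ≤ S.card := card_pos.2 hS.1
  have : steinerLength R A ≤ S.card - 1 := Nat.sInf_le ⟨S, hAS, hS, by omega⟩
  omega

omit [DecidableEq V] in
/-- Under ambient connectivity (every finite set has an `R`-connected finite superset) the Steiner
length is ATTAINED: a connected `S ⊇ A` with `#S = steinerLength A + 1`. [folklore] -/
theorem steinerLength_spec (hconn : ∀ A : Finset V, ∃ S : Finset V, A ⊆ S ∧ IsRConnected R S)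
    (A : Finset V) :
    ∃ S : Finset V, A ⊆ S ∧ IsRConnected R S ∧ S.card = steinerLength R A + 1 := by
  have hne : {n : ℕ | ∃ S : Finset V, A ⊆ S ∧ IsRConnected R S ∧ S.card = n + 1}.Nonempty := by
    obtain ⟨S, hAS, hS⟩ := hconn A
    have h1 : 1 ≤ S.card := card_pos.2 hS.1
    exact ⟨S.card - 1, S, hAS, hS, by omega⟩
  exact Nat.sInf_mem hne

omit [DecidableEq V] in
/-- `#A ≤ steinerLength A + 1`. [folklore] -/
theorem card_le_steinerLength_succ
    (hconn : ∀ A : Finset V, ∃ S : Finset V, A ⊆ S ∧ IsRConnected R S) (A : Finset V) :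
    A.card ≤ steinerLength R A + 1 := by
  obtain ⟨S, hAS, -, hcard⟩ := steinerLength_spec hconn A
  exact hcard ▸ card_le_card hAS

omit [DecidableEq V] in
/-- A single cell is `R`-connected. [folklore] -/
theorem isRConnected_singleton (x : V) : IsRConnected R ({x} : Finset V) := by
  refine ⟨⟨x, mem_singleton_self x⟩, fun v hv w hw => ?_⟩
  rw [mem_singleton] at hv hw
  subst hv; subst hw
  exact Relation.ReflTransGen.refl

omit [DecidableEq V] in
/-- **(H1)** a single cell has Steiner length `0`. [folklore] -/
theorem steinerLength_singleton (x : V) : steinerLength R ({x} : Finset V) = 0 := by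
  have h := steinerLength_succ_le (R := R) (subset_refl {x}) (isRConnected_singleton x)
  rw [card_singleton] at h
  omega

omit [DecidableEq V] in
/-- On an `R`-connected set the Steiner length is `#A - 1` (print's (2.30): `d_k(Y)` is comparable
to the number of cubes of `Y`). [folklore] -/
theorem steinerLength_of_isRConnected {A : Finset V} (hA : IsRConnected R A) :
    steinerLength R A + 1 = A.card := by
  refine le_antisymm (steinerLength_succ_le subset_rfl hA) ?_
  have h1 : 1 ≤ A.card := card_pos.2 hA.1
  obtain ⟨S, hAS, -, hcard⟩ :
      ∃ S : Finset V, A ⊆ S ∧ IsRConnected R S ∧ S.card = steinerLength R A + 1 :=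
    Nat.sInf_mem (s := {n : ℕ | ∃ S : Finset V, A ⊆ S ∧ IsRConnected R S ∧ S.card = n + 1})
      ⟨A.card - 1, A, subset_rfl, hA, by omega⟩
  exact hcard ▸ card_le_card hAS

omit [DecidableEq V] in
/-- Overlapping cell sets are geometrically incompatible (PT-D's hypothesis `hover`). [folklore] -/
theorem geomInc_of_inter_nonempty [DecidableEq V] {A B : Finset V} (h : (A ∩ B).Nonempty) :
    GeomInc R A B := by
  obtain ⟨x, hx⟩ := h
  rw [mem_inter] at hx
  unfold GeomInc Touches
  exact Or.inr ⟨x, hx.1, x, hx.2, Or.inl rfl⟩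

end Steiner

/-! ## §2 (H2) = [RG-II] (2.27): subadditivity over `GeomInc`-clusters -/

section Subadd

variable {R : V → V → Prop}

-- (filer's deviation (c): the draft's folklore helper `reflTransGen_mono_mem` is inlined below via Mathlib's
-- `Relation.ReflTransGen.mono` — the gate's `dedup.landed` matched it with NE7b's `reach_mono`, whose module is not imported here.)

/-- The union of `R`-connected supersets `S A ⊇ A` of the members of a `GeomInc R`-cluster `C` is
`R`-connected: the members reachable from a base cell form a sub-family `C₁`; if `C \ C₁ ≠ ∅` the
cluster property gives touching `A₁ ∈ C₁`, `A₂ ∉ C₁`, and the touching cell (shared or adjacent)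
makes `S A₂` reachable. [folklore] -/
theorem isRConnected_biUnion_of_cluster (hR : ∀ x y, R x y → R y x) {C : Finset (Finset V)}
    (hCne : C.Nonempty) (hCl : IsPolymerCluster (GeomInc R) C) (S : Finset V → Finset V)
    (hS : ∀ A ∈ C, A ⊆ S A ∧ IsRConnected R (S A)) : IsRConnected R (C.biUnion S) := by
  classical
  set U : Finset V := C.biUnion S with hU
  -- connectivity inside `S A ⊆ U` lifts to connectivity inside `U`
  have hlift : ∀ A ∈ C, ∀ v ∈ S A, ∀ w ∈ S A,
      Relation.ReflTransGen (fun x y => R x y ∧ x ∈ U ∧ y ∈ U) v w := by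
    intro A hA v hv w hw
    have hsub : S A ⊆ U := subset_biUnion_of_mem S hA
    exact Relation.ReflTransGen.mono (r := fun x y => R x y ∧ x ∈ S A ∧ y ∈ S A)
      (p := fun x y => R x y ∧ x ∈ U ∧ y ∈ U) (fun _ _ h' => ⟨h'.1, hsub h'.2.1, hsub h'.2.2⟩) v w
      ((hS A hA).2.2 v hv w hw)
  obtain ⟨A₀, hA₀⟩ := hCne
  obtain ⟨v₀, hv₀⟩ := (hS A₀ hA₀).2.1
  have hv₀U : v₀ ∈ U := mem_biUnion.2 ⟨A₀, hA₀, hv₀⟩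
  -- every cell of `U` is reachable from `v₀` inside `U`
  have hreach : ∀ A ∈ C, ∀ w ∈ S A,
      Relation.ReflTransGen (fun x y => R x y ∧ x ∈ U ∧ y ∈ U) v₀ w := by
    by_contra hcon
    simp only [not_forall, exists_prop] at hcon
    set C₁ : Finset (Finset V) := C.filter fun A => ∀ w ∈ S A,
      Relation.ReflTransGen (fun x y => R x y ∧ x ∈ U ∧ y ∈ U) v₀ w with hC₁
    have hC₁sub : C₁ ⊆ C := filter_subset _ _
    have hC₁ne : C₁.Nonempty :=
      ⟨A₀, mem_filter.2 ⟨hA₀, fun w hw => hlift A₀ hA₀ v₀ hv₀ w hw⟩⟩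
    have hC₂ne : (C \ C₁).Nonempty := by
      obtain ⟨A, hA, w, hw, hnot⟩ := hcon
      exact ⟨A, mem_sdiff.2 ⟨hA, fun h => hnot ((mem_filter.1 h).2 w hw)⟩⟩
    obtain ⟨A₁, hA₁, A₂, hA₂, hinc⟩ := hCl C₁ hC₁sub hC₁ne hC₂ne
    obtain ⟨hA₁C, hA₁r⟩ := mem_filter.1 hA₁
    obtain ⟨hA₂C, hA₂not⟩ := mem_sdiff.1 hA₂
    have htouch : Touches R A₁ A₂ := by
      rcases hinc with h | h
      · rw [h] at hA₁
        exact absurd hA₁ hA₂not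
      · exact h
    obtain ⟨a, ha, q, hq, haq⟩ := htouch
    have ha_reach : Relation.ReflTransGen (fun x y => R x y ∧ x ∈ U ∧ y ∈ U) v₀ a :=
      hA₁r a ((hS A₁ hA₁C).1 ha)
    have haU : a ∈ U := mem_biUnion.2 ⟨A₁, hA₁C, (hS A₁ hA₁C).1 ha⟩
    have hqS : q ∈ S A₂ := (hS A₂ hA₂C).1 hq
    have hqU : q ∈ U := mem_biUnion.2 ⟨A₂, hA₂C, hqS⟩
    have hq_reach : Relation.ReflTransGen (fun x y => R x y ∧ x ∈ U ∧ y ∈ U) v₀ q := by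
      rcases haq with rfl | haq
      · exact ha_reach
      · exact ha_reach.tail ⟨haq, haU, hqU⟩
    exact hA₂not (mem_filter.2 ⟨hA₂C, fun w hw => hq_reach.trans (hlift A₂ hA₂C q hqS w hw)⟩)
  refine ⟨⟨v₀, hv₀U⟩, fun v hv w hw => ?_⟩
  obtain ⟨A, hA, hvA⟩ := mem_biUnion.1 hv
  obtain ⟨B, hB, hwB⟩ := mem_biUnion.1 hw
  exact (reflTransGen_symm_of_symm hR (hreach A hA v hvA)).trans (hreach B hB w hwB)

/-- **(H2) = [RG-II] (2.27)** with `c₀ = 1`: for a nonempty `GeomInc R`-cluster `C`,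
`steinerLength (⋃ C) + 1 ≤ Σ_{A ∈ C} (steinerLength A + 1)` (join the Steiner trees of the
members: their union is connected by `isRConnected_biUnion_of_cluster`). [cite: Balaban1988RG2Cluster,
(2.27) p.18; folklore] -/
theorem steiner_subadd (hR : ∀ x y, R x y → R y x)
    (hconn : ∀ A : Finset V, ∃ S : Finset V, A ⊆ S ∧ IsRConnected R S)
    {C : Finset (Finset V)} (hCne : C.Nonempty) (hCl : IsPolymerCluster (GeomInc R) C) :
    steinerLength R (clusterSupp C) + 1 ≤ ∑ A ∈ C, (steinerLength R A + 1) := by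
  classical
  choose S hS using fun A : Finset V => steinerLength_spec hconn A
  have hU : IsRConnected R (C.biUnion S) :=
    isRConnected_biUnion_of_cluster hR hCne hCl S fun A _ => ⟨(hS A).1, (hS A).2.1⟩
  have hsub : clusterSupp C ⊆ C.biUnion S := by
    intro x hx
    obtain ⟨A, hA, hxA⟩ := mem_biUnion.1 hx
    exact mem_biUnion.2 ⟨A, hA, (hS A).1 hxA⟩
  calc steinerLength R (clusterSupp C) + 1 ≤ (C.biUnion S).card := steinerLength_succ_le hsub hU
    _ ≤ ∑ A ∈ C, (S A).card := card_biUnion_le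
    _ = ∑ A ∈ C, (steinerLength R A + 1) := sum_congr rfl fun A _ => (hS A).2.2

/-- (H2) in PT-D's real form (`ℓ := steinerLength`, `c₀ := 1`). [cite: Balaban1988RG2Cluster, (2.27) p.18] -/
theorem steiner_subadd_real (hR : ∀ x y, R x y → R y x)
    (hconn : ∀ A : Finset V, ∃ S : Finset V, A ⊆ S ∧ IsRConnected R S)
    {C : Finset (Finset V)} (hCne : C.Nonempty) (hCl : IsPolymerCluster (GeomInc R) C) :
    (steinerLength R (clusterSupp C) : ℝ) + 1 ≤ ∑ A ∈ C, ((steinerLength R A : ℝ) + 1) := by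
  exact_mod_cast steiner_subadd hR hconn hCne hCl

end Subadd

/-! ## §3 (H3) = [RG-II] (2.29)/(2.30): the entropy bound for the Steiner length -/

section Entropy

variable {R : V → V → Prop} {nbr : V → Finset V} {Δ : ℕ}

/-- **(H3), finite form.** If `#(nbr x) ≤ Δ` lists the `R`-neighbours (`R` symmetric), every finite
set has a connected superset, and `4 (Δ + 1)² ≤ e^b`, then for every finite family `𝒜` of cell sets
geometrically incompatible with `A`:
`Σ_{A' ∈ 𝒜} e^{-b · steinerLength A'} ≤ 4 (Δ + 1) (steinerLength A + 1)`.
Proof: `A' ⊆ S(A')` (its Steiner superset, `R`-connected, `#S = steinerLength A' + 1`, through a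
cell of `Nb(A)`); the fibre over `S` has `≤ 2^{#S}` members, so the sum is
`≤ e^b Σ_{v ∈ Nb(A)} Σ_{S ∋ v connected} (2e^{-b})^{#S} ≤ e^b · (Δ+1) #A · 4 e^{-b}` by the landed
`sum_pow_card_le_of_connected`. [cite: Balaban1988RG2Cluster, (2.29) p.18; Cammarota CMP 85 (1982); folklore] -/
theorem steiner_entropy_finset (hR : ∀ x y, R x y → R y x) (hΔ : ∀ x, (nbr x).card ≤ Δ)
    (hnbr : ∀ x y, R x y → y ∈ nbr x)
    (hconn : ∀ A : Finset V, ∃ S : Finset V, A ⊆ S ∧ IsRConnected R S)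
    {b : ℝ} (hb : 4 * ((Δ : ℝ) + 1) ^ 2 ≤ Real.exp b) (A : Finset V) (𝒜 : Finset (Finset V))
    (h𝒜 : ∀ A' ∈ 𝒜, GeomInc R A' A) :
    ∑ A' ∈ 𝒜, Real.exp (-b * (steinerLength R A' : ℝ)) ≤
      4 * ((Δ : ℝ) + 1) * ((steinerLength R A : ℝ) + 1) := by
  classical
  choose S hS using fun A : Finset V => steinerLength_spec hconn A
  -- constants
  have h4 : (4 : ℝ) ≤ Real.exp b :=
    le_trans (by nlinarith [(Nat.cast_nonneg Δ : (0 : ℝ) ≤ Δ)]) hb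
  have hb0 : 0 ≤ b := by
    by_contra h
    have h' : b < 0 := lt_of_not_ge h
    have := Real.exp_lt_exp.2 h'
    rw [Real.exp_zero] at this
    linarith
  set lam : ℝ := 2 * Real.exp (-b) with hlam_def
  have hlam : 0 ≤ lam := by positivity
  have hee : Real.exp b * Real.exp (-b) = 1 := by rw [← Real.exp_add, add_neg_cancel, Real.exp_zero]
  have hsmall : ((Δ : ℝ) + 1) ^ 2 * lam ≤ 1 / 2 := by
    -- `(Δ+1)² · 2 e^{-b} ≤ 1/2 ⟸ 4 (Δ+1)² ≤ e^b`
    have hpos : 0 < Real.exp (-b) := Real.exp_pos _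
    have : ((Δ : ℝ) + 1) ^ 2 * lam * Real.exp b ≤ 1 / 2 * Real.exp b := by
      calc ((Δ : ℝ) + 1) ^ 2 * lam * Real.exp b
          = 2 * ((Δ : ℝ) + 1) ^ 2 * (Real.exp b * Real.exp (-b)) := by rw [hlam_def]; ring
        _ = 1 / 2 * (4 * ((Δ : ℝ) + 1) ^ 2) := by rw [hee]; ring
        _ ≤ 1 / 2 * Real.exp b := by gcongr
    exact le_of_mul_le_mul_right this (Real.exp_pos b)
  -- the weight of `A'` in terms of its Steiner superset
  have hw : ∀ A', Real.exp (-b * (steinerLength R A' : ℝ)) =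
      Real.exp b * Real.exp (-b) ^ (S A').card := by
    intro A'
    rw [(hS A').2.2, ← Real.exp_nat_mul, ← Real.exp_add]
    congr 1
    push_cast
    ring
  by_cases hA : A = ∅
  · -- only `A' = ∅` is incompatible with `∅`
    subst hA
    have h𝒜' : 𝒜 ⊆ {∅} := by
      intro A' hA'
      rcases h𝒜 A' hA' with h | ⟨w, hw, q, hq, _⟩
      · exact mem_singleton.2 h
      · simp at hq
    have hs0 : (0 : ℝ) ≤ (steinerLength R (∅ : Finset V) : ℝ) := Nat.cast_nonneg _
    calc ∑ A' ∈ 𝒜, Real.exp (-b * (steinerLength R A' : ℝ))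
        ≤ ∑ A' ∈ ({∅} : Finset (Finset V)), Real.exp (-b * (steinerLength R A' : ℝ)) :=
          sum_le_sum_of_subset_of_nonneg h𝒜' fun _ _ _ => Real.exp_nonneg _
      _ = Real.exp (-b * (steinerLength R (∅ : Finset V) : ℝ)) := sum_singleton _ _
      _ ≤ 1 := by
          rw [← Real.exp_zero]
          exact Real.exp_le_exp.2 (by nlinarith)
      _ ≤ 4 * ((Δ : ℝ) + 1) * ((steinerLength R (∅ : Finset V) : ℝ) + 1) := by
          nlinarith [(Nat.cast_nonneg Δ : (0 : ℝ) ≤ Δ)]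
  · have hAne : A.Nonempty := nonempty_iff_ne_empty.2 hA
    -- the cells of `A` and their neighbours
    set Nb : Finset V := A.biUnion fun a => insert a (nbr a) with hNb
    have hNbcard : (Nb.card : ℝ) ≤ ((Δ : ℝ) + 1) * A.card := by
      have : Nb.card ≤ (Δ + 1) * A.card := by
        refine card_biUnion_le.trans ?_
        calc ∑ a ∈ A, (insert a (nbr a)).card ≤ ∑ _a ∈ A, (Δ + 1) :=
              sum_le_sum fun a _ => (card_insert_le _ _).trans (Nat.add_le_add_right (hΔ a) 1)
          _ = (Δ + 1) * A.card := by rw [sum_const, smul_eq_mul, mul_comm]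
      exact_mod_cast this
    -- each Steiner superset `S A'`, `A' ∈ 𝒜`, contains a cell of `Nb`
    have hmeet : ∀ A' ∈ 𝒜, ∃ v ∈ Nb, v ∈ S A' := by
      intro A' hA'
      rcases h𝒜 A' hA' with h | ⟨w, hw, q, hq, hwq⟩
      · obtain ⟨a, ha⟩ := hAne
        refine ⟨a, mem_biUnion.2 ⟨a, ha, mem_insert_self _ _⟩, (hS A').1 ?_⟩
        rw [h]
        exact ha
      · refine ⟨w, mem_biUnion.2 ⟨q, hq, ?_⟩, (hS A').1 hw⟩
        rcases hwq with rfl | hwq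
        · exact mem_insert_self _ _
        · exact mem_insert_of_mem (hnbr _ _ (hR _ _ hwq))
    -- Step 1: group the `A'` by their Steiner superset; fibres have `≤ 2^{#S}` members
    have step1 : ∑ A' ∈ 𝒜, Real.exp (-b * (steinerLength R A' : ℝ)) ≤
        ∑ T ∈ 𝒜.image S, Real.exp b * lam ^ T.card := by
      rw [← sum_fiberwise_of_maps_to (g := S) (t := 𝒜.image S)
        (fun A' hA' => mem_image_of_mem S hA')]
      refine sum_le_sum fun T _ => ?_
      have hterm : ∀ A' ∈ 𝒜.filter (fun A' => S A' = T),
          Real.exp (-b * (steinerLength R A' : ℝ)) = Real.exp b * Real.exp (-b) ^ T.card := by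
        intro A' hA'
        rw [hw A', (mem_filter.1 hA').2]
      rw [sum_congr rfl hterm, sum_const, nsmul_eq_mul]
      have hcount : ((𝒜.filter fun A' => S A' = T).card : ℝ) ≤ 2 ^ T.card := by
        have : (𝒜.filter fun A' => S A' = T).card ≤ T.powerset.card := by
          refine card_le_card fun A' hA' => ?_
          obtain ⟨-, hT'⟩ := mem_filter.1 hA'
          exact mem_powerset.2 (hT' ▸ (hS A').1)
        rw [card_powerset] at this
        exact_mod_cast this
      calc ((𝒜.filter fun A' => S A' = T).card : ℝ) * (Real.exp b * Real.exp (-b) ^ T.card)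
          ≤ 2 ^ T.card * (Real.exp b * Real.exp (-b) ^ T.card) :=
            mul_le_mul_of_nonneg_right hcount (by positivity)
        _ = Real.exp b * lam ^ T.card := by rw [hlam_def, mul_pow]; ring
    -- Step 2: distribute over the cell of `Nb` each superset contains
    have step2 : ∑ T ∈ 𝒜.image S, lam ^ T.card ≤
        ∑ v ∈ Nb, ∑ T ∈ (𝒜.image S) with v ∈ T, lam ^ T.card := by
      have hkey : ∀ T ∈ 𝒜.image S, lam ^ T.card ≤ ∑ v ∈ Nb with v ∈ T, lam ^ T.card := by
        intro T hT
        obtain ⟨A', hA', rfl⟩ := mem_image.1 hT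
        obtain ⟨v, hvNb, hvT⟩ := hmeet A' hA'
        have hmem : v ∈ Nb.filter fun u => u ∈ S A' := mem_filter.2 ⟨hvNb, hvT⟩
        calc lam ^ (S A').card = ∑ _u ∈ ({v} : Finset V), lam ^ (S A').card := by simp
          _ ≤ ∑ u ∈ Nb with u ∈ S A', lam ^ (S A').card :=
              sum_le_sum_of_subset_of_nonneg (by simpa using hmem) fun _ _ _ => pow_nonneg hlam _
      calc ∑ T ∈ 𝒜.image S, lam ^ T.card
          ≤ ∑ T ∈ 𝒜.image S, ∑ v ∈ Nb with v ∈ T, lam ^ T.card := sum_le_sum hkey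
        _ = ∑ v ∈ Nb, ∑ T ∈ (𝒜.image S) with v ∈ T, lam ^ T.card := by
            rw [sum_comm' (t' := Nb) (s' := fun v => (𝒜.image S).filter fun T => v ∈ T)]
            intro T v
            simp only [mem_filter]
            tauto
    -- Step 3: the lattice-animal bound through each cell
    have step3 : ∀ v ∈ Nb, ∑ T ∈ (𝒜.image S) with v ∈ T, lam ^ T.card ≤ 2 * lam := by
      intro v _
      refine sum_pow_card_le_of_connected hR hΔ hnbr hlam hsmall v _ fun T hT => ?_
      obtain ⟨hT, hvT⟩ := mem_filter.1 hT
      obtain ⟨A', -, rfl⟩ := mem_image.1 hT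
      exact ⟨hvT, (hS A').2.1⟩
    have hcardA : (A.card : ℝ) ≤ (steinerLength R A : ℝ) + 1 := by
      exact_mod_cast card_le_steinerLength_succ hconn A
    calc ∑ A' ∈ 𝒜, Real.exp (-b * (steinerLength R A' : ℝ))
        ≤ ∑ T ∈ 𝒜.image S, Real.exp b * lam ^ T.card := step1
      _ = Real.exp b * ∑ T ∈ 𝒜.image S, lam ^ T.card := by rw [mul_sum]
      _ ≤ Real.exp b * ∑ v ∈ Nb, ∑ T ∈ (𝒜.image S) with v ∈ T, lam ^ T.card :=
          mul_le_mul_of_nonneg_left step2 (Real.exp_nonneg _)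
      _ ≤ Real.exp b * ∑ _v ∈ Nb, 2 * lam :=
          mul_le_mul_of_nonneg_left (sum_le_sum step3) (Real.exp_nonneg _)
      _ = 4 * Nb.card * (Real.exp b * Real.exp (-b)) := by
          rw [sum_const, nsmul_eq_mul, hlam_def]
          ring
      _ = 4 * Nb.card := by rw [hee, mul_one]
      _ ≤ 4 * (((Δ : ℝ) + 1) * A.card) := by gcongr
      _ ≤ 4 * (((Δ : ℝ) + 1) * ((steinerLength R A : ℝ) + 1)) := by gcongr
      _ = 4 * ((Δ : ℝ) + 1) * ((steinerLength R A : ℝ) + 1) := by ring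

/-- **(H3) = [RG-II] (2.29)/(2.30)** in PT-D's form (`ℓ := steinerLength`, `N := 4 (Δ + 1)`):
summability over all cell sets incompatible with `A` and the bound `Σ' ≤ 4 (Δ+1) (steinerLength A + 1)`
(from the finite form by `summable_of_sum_le` / `Real.tsum_le_of_sum_le`). [cite: Balaban1988RG2Cluster,
(2.29) p.18; folklore] -/
theorem steiner_entropy (hR : ∀ x y, R x y → R y x) (hΔ : ∀ x, (nbr x).card ≤ Δ)
    (hnbr : ∀ x y, R x y → y ∈ nbr x)
    (hconn : ∀ A : Finset V, ∃ S : Finset V, A ⊆ S ∧ IsRConnected R S)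
    {b : ℝ} (hb : 4 * ((Δ : ℝ) + 1) ^ 2 ≤ Real.exp b) (A : Finset V) :
    Summable (fun A' : {A' : Finset V // GeomInc R A' A} =>
        Real.exp (-b * (steinerLength R (A' : Finset V) : ℝ))) ∧
      ∑' A' : {A' : Finset V // GeomInc R A' A},
          Real.exp (-b * (steinerLength R (A' : Finset V) : ℝ)) ≤
        4 * ((Δ : ℝ) + 1) * ((steinerLength R A : ℝ) + 1) := by
  classical
  have hnn : (0 : {A' : Finset V // GeomInc R A' A} → ℝ) ≤
      fun A' : {A' : Finset V // GeomInc R A' A} =>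
        Real.exp (-b * (steinerLength R (A' : Finset V) : ℝ)) :=
    fun _ => Real.exp_nonneg _
  have hbound : ∀ s : Finset {A' : Finset V // GeomInc R A' A},
      ∑ x ∈ s, Real.exp (-b * (steinerLength R (x : Finset V) : ℝ)) ≤
        4 * ((Δ : ℝ) + 1) * ((steinerLength R A : ℝ) + 1) := by
    intro s
    have h := steiner_entropy_finset hR hΔ hnbr hconn hb A
      (s.map (Function.Embedding.subtype _)) fun A' hA' => by
        obtain ⟨x, _, rfl⟩ := mem_map.1 hA'
        exact x.2
    simpa [sum_map] using h
  exact ⟨summable_of_sum_le hnn hbound, Real.tsum_le_of_sum_le hnn hbound⟩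

end Entropy

end Summit.QuantumFields.YangMills.Theorems.SteinerResummationDraft

end
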